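/-
Copyright (c) 2026 the pub-hodgecm-mathlib formalisation cell (harness21).  Prover seat hodgecm-mathlib-F0P3-p03 (g15): road «S3-ram» (LEAD F0P3a-plan (g12∕g13); owner
F0P3a-p06 (g15)); junction J-PACK v2-iso (pen F0P3a-p01 (g17); S45 hand F0P3a-p02 (g17)), row REGION CRITERION of the isoceles wave (file 1 of 2); 2026-09-02.
-/
import Literature.NumberTheory.Automorphic.UnitaryLatticeTreeRegionUpClosedRamified   -- ★ p847610 (F0P3-p04 (g14)): `dist_root_eq_of_frames`, `sub_one_eq_conj_diagonal_sub_one`; brings ★ G3⁺, frames, Apartment, Dual, Types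
import Literature.NumberTheory.Automorphic.UnitaryLatticeTreeRootGrandchildLabelsRamified   -- ★ p847534 (F0P3a-p04 (g19)): `pairing_diagonal_apply`
import HarnessLib

/-!
# The lattice graph of a hermitian space — THE ISOCELES REGION IS THE SET OF SPLIT SELF-DUAL LATTICES OF BOUNDED CONTENT (tame-ramified place)
# (Bruhat–Tits 1972 §10; Kottwitz 1986 §3; Serre, *Trees* II.1.1)

Topic `NumberTheory/Automorphic`; namespace `Literature.NumberTheory.Automorphic.UnitaryLatticeTree`.  THEOREMS ONLY (no definition, no instance, no notation, no named fact,
no `sorry`); kernel lane `--supports stmt-HodgeConjecture-24833`.  Cell `pub/hodgecm-mathlib` (D-0151), crux H413; road «S3-ram» (Literature seeding, count-neutral); junction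
(J★) of the type-(1) ramified organ, ISOCELES wave (S45 sockets `row_regionCard` ∕ `row_pooledLineCounts`, hand F0P3a-p02 (g17); rows RGC ∕ DIST ∕ SHAPE named on the bus
2026-09-02T01:32Z ∕ 01:57Z).

THE SETTING.  `γ = A·diag(s)·A⁻¹` with `A ∈ GL₃(K)` (the eigenframe; columns `u_m = A e_m`), an ISOLATED index `i₀` and the CLOSE PAIR `{j, k} = {0,1,2} ∖ {i₀}`:
`|s_{i₀} − s_m| = |ϖ|^{d₀}` for `m ≠ i₀`, `|s_j − s_k| = |ϖ|^{d₀ + 2s'}`, `|s_m − 1| ≤ |ϖ|^{d₀}`.  For an `𝒪`-submodule `M ≤ K³` write `LEV[M](ϖ^{d₀})` for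
`(γ − 1)·M ≤ ϖ^{d₀}·M` and `c(z) = A⁻¹z` for the eigen-coordinates of `z` (`z = Σ_m c_m(z)·u_m`).

§1 EIGEN-COORDINATES.  `(γ − 1)z − (s_j − 1)z = Σ_m (s_m − s_j)·c_m(z)·u_m` (the `m = j` term vanishes), and the operators `T_e : z ↦ Σ_m e_m c_m(z) u_m` compose
coordinatewise.  §2 THE MODULE CRITERION (any `𝒪`-submodule `M`): **`LEV[M](ϖ^{d₀}) ↔ (∀ z ∈ M, c_{i₀}(z)·u_{i₀} ∈ M) ∧ (∀ z ∈ M, ϖ^{2s'}·c_k(z)·u_k ∈ M)`**: `⇒` because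
`T_j := ϖ^{−d₀}(γ − 1 − (s_j − 1))` and `T_k` preserve `M` and `T_k T_j z = e·c_{i₀}(z)u_{i₀}` with `e` a unit (the `j`- and `k`-coordinates are killed one each), then
`ϖ^{2s'}c_k(z)u_k = unit·(T_j z − e'·c_{i₀}(z)u_{i₀})`; `⇐` by the same expansion.  §3 SELF-DUAL `M` (for `J₀ = antidiag(1,1,1)`, eigenframe Gram `diag(d)∕(−det diag d)` with
unit `d`, so `⟨z, u_m⟩ = κ₀·σ(c_m(z))·d_m`): `c_{i₀}(z)u_{i₀} ∈ M` for all `z ∈ M` iff `u_{i₀} ∈ M`, and `ϖ^{2s'}c_k(z)u_k ∈ M` for all `z ∈ M` iff `ϖ^{s'}u_k ∈ M`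
(integrality `⟨M, M⟩ ≤ 𝒪` bounds `N(c_{i₀})`, `ϖ^{2s'}N(c_k)`; then `M = M♯`).  Hence the **REGION CRITERION**: for self-dual `M`, `LEV[M](ϖ^{d₀}) ↔ u_{i₀} ∈ M ∧ ϖ^{s'}u_k ∈ M`.
§4 DEPTH: for self-dual `M ∋ u_{i₀}`, `ϖⁿ·𝒪³ ≤ M ↔ ϖⁿu_k ∈ M` (the `u_j`- and `u_k`-contents agree by `⟨z,z⟩ ∈ 𝒪`), so `latticeDepth M ≤ n ↔ ϖⁿ u_k ∈ M`; with ★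
`dist_root_eq_of_frames` the region lies in the ball of radius `2s'` and a region vertex at distance `2s'` has no region vertex two steps further out (the END half of DIST).
§5 THE HYPERBOLICITY CONSTRAINT: a region vertex other than `r₀` forces `−d_j∕d_k` to be a norm residue (`∃ t, |t| = 1, |d_j + tσ(t)d_k| < 1`): in the residually
ANISOTROPIC case the region is `{r₀}` (the «bare-root» literals of B-p14 (g39)'s census 8a5ec485).

§6 DIST (frames form and tame-ramified form): region ⟹ `dist(r₀, ·) ≤ 2s'`; at distance `2s' + 2` no self-dual vertex carries the token.

* §1 `sub_one_mulVec_sub_smul_eq`, `mulVec_mul_inv_mulVec_mulVec` (eigen-coordinates).  §2 `mulVec_levelShift_mem_of_lev`, **`coord_smul_mulVec_single_mem_of_lev`**,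
  **`pow_mul_coord_smul_mulVec_single_mem_of_lev`**, **`lev_of_coord_smul_mulVec_single_mem`** (the module criterion).  §3 `pairing_coe_mulVec_coe_mulVec_eq_sum`,
  `pairing_coe_mulVec_single_eq`, `pairing_single_coe_mulVec_eq`, **`coe_mulVec_single_mem_iff_forall_coord_smul_mem`**, **`pow_smul_coe_mulVec_single_mem_iff_forall`**,
  **`map_sub_one_le_scaleLattice_iff_mem_and_mem_of_isSelfDualLattice`** (THE REGION CRITERION).

HONEST LABEL: HC_CM is proved only modulo the 2 remaining named inputs (hLiu418 24832, h413 24833) until rung 0 closes; nothing printed is asserted here (module algebra over a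
valuation ring); «S3-ram» has no books consequence.

## References
* [BruhatTits1972] F. Bruhat, J. Tits, *Groupes réductifs sur un corps local I*, Publ. Math. IHÉS 41 (1972), §10 (lattice models of the rank-one building; fixed points of tori).
* [Kottwitz1986] R. E. Kottwitz, *Base change for unit elements of Hecke algebras*, Compositio Math. 60 (1986), §3 (fixed lattices of a torus element: split lattices of bounded content).
* [Serre1980Trees] J.-P. Serre, *Trees* (1980), Ch. II §1.1 (lattices, distance from a base lattice).
* [Tits1979] J. Tits, *Reductive groups over local fields*, PSPM 33.1 (1979), §3.5.
-/

set_option autoImplicit false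

noncomputable section

open scoped Valued WithZero Matrix MatrixGroups

namespace Literature.NumberTheory.Automorphic.UnitaryLatticeTree

open Literature.NumberTheory.Automorphic Literature.NumberTheory.Automorphic.HermitianLattice

variable {K : Type*} [Field K] [Valued K ℤᵐ⁰] {σ : K →+* K} {ϖ : K}

/-! ## §0 Two helpers: integral scalars act on `𝒪`-submodules; the three indices -/

/-- An element of valuation `≤ 1` acts on any `𝒪`-submodule of `K^N`. [cite: Serre1980Trees, II.1.1] -/
theorem smul_mem_of_v_le_one {N : ℕ} (M : Submodule 𝒪[K] (Fin N → K)) {a : K} (ha : Valued.v a ≤ 1) {x : Fin N → K} (hx : x ∈ M) : a • x ∈ M :=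
  M.smul_mem (⟨a, ha⟩ : 𝒪[K]) hx

omit [Valued K ℤᵐ⁰] in
/-- The three indices of `Fin 3`: every `m` is `i₀`, `i₀ + 1` or `i₀ + 2`, and these are pairwise distinct. [cite: Serre1980Trees, II.1.1] -/
theorem fin_three_eq_or (i₀ m : Fin 3) : (m = i₀ ∨ m = i₀ + 1 ∨ m = i₀ + 2) ∧ i₀ + 1 ≠ i₀ ∧ i₀ + 2 ≠ i₀ ∧ i₀ + 1 ≠ i₀ + 2 := by
  fin_cases i₀ <;> fin_cases m <;> decide

/-! ## §1 Eigen-coordinates -/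

omit [Valued K ℤᵐ⁰] in
/-- `z = A·(A⁻¹z)`: the eigen-coordinates reproduce the vector. [cite: Kottwitz1986, §3] -/
theorem coe_mulVec_inv_mulVec (A : GL (Fin 3) K) (z : Fin 3 → K) :
    (A : Matrix (Fin 3) (Fin 3) K) *ᵥ (((A⁻¹ : GL (Fin 3) K) : Matrix (Fin 3) (Fin 3) K) *ᵥ z) = z := by
  rw [Matrix.mulVec_mulVec, ← Units.val_mul, mul_inv_cancel, Units.val_one, Matrix.one_mulVec]

omit [Valued K ℤᵐ⁰] in
/-- `A⁻¹·(A w) = w`. [cite: Kottwitz1986, §3] -/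
theorem inv_mulVec_coe_mulVec (A : GL (Fin 3) K) (w : Fin 3 → K) :
    (((A⁻¹ : GL (Fin 3) K) : Matrix (Fin 3) (Fin 3) K)) *ᵥ ((A : Matrix (Fin 3) (Fin 3) K) *ᵥ w) = w := by
  rw [Matrix.mulVec_mulVec, ← Units.val_mul, inv_mul_cancel, Units.val_one, Matrix.one_mulVec]

omit [Valued K ℤᵐ⁰] in
/-- A vector supported at one index: `A·w = w_{i}·(A e_i)` if `w_m = 0` for `m ≠ i`. [cite: Kottwitz1986, §3] -/
theorem mulVec_eq_smul_mulVec_single_of_forall_ne (A : Matrix (Fin 3) (Fin 3) K) {w : Fin 3 → K} (i : Fin 3) (hw : ∀ m, m ≠ i → w m = 0) :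
    A *ᵥ w = w i • (A *ᵥ Pi.single i 1) := by
  have hws : w = w i • (Pi.single i 1 : Fin 3 → K) := by
    funext m
    by_cases hm : m = i
    · subst hm; simp
    · rw [Pi.smul_apply, Pi.single_eq_of_ne hm, smul_zero]; exact hw m hm
  conv_lhs => rw [hws]
  rw [Matrix.mulVec_smul]

omit [Valued K ℤᵐ⁰] in
/-- **`(γ − 1)z − (s_j − 1)z = A·((s − s_j)·c(z))`** for `γ = A·diag(s)·A⁻¹`, `c(z) = A⁻¹z`. [cite: Kottwitz1986, §3] [cite: Tits1979, §3.5] -/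
theorem sub_one_mulVec_sub_smul_eq (A : GL (Fin 3) K) (s : Fin 3 → K) {γm : Matrix (Fin 3) (Fin 3) K}
    (hγA : γm = (A : Matrix (Fin 3) (Fin 3) K) * Matrix.diagonal s * ((A⁻¹ : GL (Fin 3) K) : Matrix (Fin 3) (Fin 3) K)) (j : Fin 3) (z : Fin 3 → K) :
    (γm - 1) *ᵥ z - (s j - 1) • z =
      (A : Matrix (Fin 3) (Fin 3) K) *ᵥ (fun m => (s m - s j) * ((((A⁻¹ : GL (Fin 3) K) : Matrix (Fin 3) (Fin 3) K)) *ᵥ z) m) := by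
  set c : Fin 3 → K := (((A⁻¹ : GL (Fin 3) K) : Matrix (Fin 3) (Fin 3) K)) *ᵥ z with hc
  have hz : z = (A : Matrix (Fin 3) (Fin 3) K) *ᵥ c := (coe_mulVec_inv_mulVec A z).symm
  have hdiag : Matrix.diagonal (fun i => s i - 1) *ᵥ c = fun m => (s m - 1) * c m := funext fun m => Matrix.mulVec_diagonal _ _ m
  rw [sub_one_eq_conj_diagonal_sub_one A s hγA, ← Matrix.mulVec_mulVec, ← Matrix.mulVec_mulVec, ← hc, hdiag]
  conv_lhs => rw [hz, ← Matrix.mulVec_smul, ← Matrix.mulVec_sub]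
  congr 1
  funext m
  simp only [Pi.sub_apply, Pi.smul_apply, smul_eq_mul]
  ring

omit [Valued K ℤᵐ⁰] in
/-- Coordinatewise operators compose coordinatewise: `A·(e · A⁻¹(A·(e' · c))) = A·((e·e')·c)`. [cite: Kottwitz1986, §3] -/
theorem mulVec_mul_inv_mulVec_mulVec (A : GL (Fin 3) K) (e e' c : Fin 3 → K) :
    (A : Matrix (Fin 3) (Fin 3) K) *ᵥ (fun m => e m * ((((A⁻¹ : GL (Fin 3) K) : Matrix (Fin 3) (Fin 3) K)) *ᵥ ((A : Matrix (Fin 3) (Fin 3) K) *ᵥ fun m => e' m * c m)) m) =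
      (A : Matrix (Fin 3) (Fin 3) K) *ᵥ (fun m => e m * e' m * c m) := by
  rw [inv_mulVec_coe_mulVec]
  congr 1
  funext m
  ring

/-! ## §2 The module criterion: `LEV[M](ϖ^{d₀})` iff the `u_{i₀}`-coordinate projection and `ϖ^{2s'}`·(the `u_k`-coordinate projection) preserve `M` -/

/-- **THE OPERATOR `T_j = ϖ^{−d₀}(γ − 1 − (s_j − 1))` PRESERVES `M`** when `LEV[M](ϖ^{d₀})` and `|s_j − 1| ≤ |ϖ|^{d₀}`:
`A·((ϖ^{−d₀}(s − s_j))·c(z)) ∈ M` for `z ∈ M`. [cite: Kottwitz1986, §3] -/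
theorem mulVec_levelShift_mem_of_lev (hϖ : Valued.v ϖ = WithZero.exp (-1 : ℤ)) (A : GL (Fin 3) K) (s : Fin 3 → K) {γm : Matrix (Fin 3) (Fin 3) K}
    (hγA : γm = (A : Matrix (Fin 3) (Fin 3) K) * Matrix.diagonal s * ((A⁻¹ : GL (Fin 3) K) : Matrix (Fin 3) (Fin 3) K)) {d₀ : ℕ} (j : Fin 3)
    (hej : Valued.v (s j - 1) ≤ Valued.v ϖ ^ d₀) {M : Submodule 𝒪[K] (Fin 3 → K)}
    (hlev : M.map ((Matrix.toLin' (γm - 1)).restrictScalars 𝒪[K]) ≤ scaleLattice (ϖ ^ d₀) M) {z : Fin 3 → K} (hz : z ∈ M) :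
    (A : Matrix (Fin 3) (Fin 3) K) *ᵥ (fun m => (ϖ ^ d₀)⁻¹ * (s m - s j) * ((((A⁻¹ : GL (Fin 3) K) : Matrix (Fin 3) (Fin 3) K)) *ᵥ z) m) ∈ M := by
  have hϖ0 : ϖ ≠ 0 := fun h0 => by rw [h0, map_zero] at hϖ; exact WithZero.coe_ne_zero hϖ.symm
  have hpd : (ϖ : K) ^ d₀ ≠ 0 := pow_ne_zero _ hϖ0
  -- `ϖ^{-d₀}(γ−1)z ∈ M`
  have h1 : (ϖ ^ d₀)⁻¹ • ((γm - 1) *ᵥ z) ∈ M := by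
    have h := hlev ⟨z, hz, rfl⟩
    rw [mem_scaleLattice_iff hpd] at h
    exact h
  -- `ϖ^{-d₀}(s_j − 1) z ∈ M`
  have h2 : ((ϖ ^ d₀)⁻¹ * (s j - 1)) • z ∈ M := by
    refine smul_mem_of_v_le_one M ?_ hz
    rw [map_mul, map_inv₀, map_pow]
    calc (Valued.v ϖ ^ d₀)⁻¹ * Valued.v (s j - 1) ≤ (Valued.v ϖ ^ d₀)⁻¹ * Valued.v ϖ ^ d₀ := mul_le_mul' le_rfl hej
      _ = 1 := inv_mul_cancel₀ (by rw [← map_pow]; exact (Valuation.ne_zero_iff _).2 hpd)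
  have h3 := M.sub_mem h1 h2
  have e : (ϖ ^ d₀)⁻¹ • ((γm - 1) *ᵥ z) - ((ϖ ^ d₀)⁻¹ * (s j - 1)) • z = (ϖ ^ d₀)⁻¹ • ((γm - 1) *ᵥ z - (s j - 1) • z) := by
    rw [smul_sub, mul_smul]
  rw [e, sub_one_mulVec_sub_smul_eq A s hγA j z, ← Matrix.mulVec_smul] at h3
  convert h3 using 2
  funext m
  simp only [Pi.smul_apply, smul_eq_mul]
  ring

/-- **`LEV[M](ϖ^{d₀})` ⇒ the `u_{i₀}`-coordinate projection preserves `M`**: `c_{i₀}(z)·u_{i₀} ∈ M` for every `z ∈ M` (any `𝒪`-submodule `M`; isoceles eigen-data at `i₀`: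
`|s_{i₀} − s_m| = |ϖ|^{d₀}` for `m ≠ i₀`, `|s_m − 1| ≤ |ϖ|^{d₀}`).  Proof: `T_k T_j z = e·c_{i₀}(z)u_{i₀}` with `e = ϖ^{−2d₀}(s_{i₀}−s_j)(s_{i₀}−s_k)` a unit.
[cite: Kottwitz1986, §3] [cite: BruhatTits1972, §10] -/
theorem coord_smul_mulVec_single_mem_of_lev (hϖ : Valued.v ϖ = WithZero.exp (-1 : ℤ)) (A : GL (Fin 3) K) (s : Fin 3 → K) {γm : Matrix (Fin 3) (Fin 3) K}
    (hγA : γm = (A : Matrix (Fin 3) (Fin 3) K) * Matrix.diagonal s * ((A⁻¹ : GL (Fin 3) K) : Matrix (Fin 3) (Fin 3) K)) (i₀ : Fin 3) {d₀ : ℕ}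
    (he : ∀ i, Valued.v (s i - 1) ≤ Valued.v ϖ ^ d₀) (hiso : ∀ m, m ≠ i₀ → Valued.v (s i₀ - s m) = Valued.v ϖ ^ d₀)
    {M : Submodule 𝒪[K] (Fin 3 → K)} (hlev : M.map ((Matrix.toLin' (γm - 1)).restrictScalars 𝒪[K]) ≤ scaleLattice (ϖ ^ d₀) M) {z : Fin 3 → K} (hz : z ∈ M) :
    ((((A⁻¹ : GL (Fin 3) K) : Matrix (Fin 3) (Fin 3) K)) *ᵥ z) i₀ • ((A : Matrix (Fin 3) (Fin 3) K) *ᵥ Pi.single i₀ 1) ∈ M := by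
  have hϖ0 : ϖ ≠ 0 := fun h0 => by rw [h0, map_zero] at hϖ; exact WithZero.coe_ne_zero hϖ.symm
  have hvϖ0 : Valued.v ϖ ≠ 0 := (Valuation.ne_zero_iff _).2 hϖ0
  have hpd : (ϖ : K) ^ d₀ ≠ 0 := pow_ne_zero _ hϖ0
  obtain ⟨-, hj, hk, hjk⟩ := fin_three_eq_or i₀ i₀
  set j : Fin 3 := i₀ + 1 with hjdef
  set k : Fin 3 := i₀ + 2 with hkdef
  set c : Fin 3 → K := (((A⁻¹ : GL (Fin 3) K) : Matrix (Fin 3) (Fin 3) K)) *ᵥ z with hc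
  -- `T_j z ∈ M`, then `T_k (T_j z) ∈ M`
  have hTj := mulVec_levelShift_mem_of_lev hϖ A s hγA j (he j) hlev hz
  have hTkTj := mulVec_levelShift_mem_of_lev hϖ A s hγA k (he k) hlev hTj
  rw [← hc] at hTj
  have hcomp : (A : Matrix (Fin 3) (Fin 3) K) *ᵥ (fun m => (ϖ ^ d₀)⁻¹ * (s m - s k) *
      ((((A⁻¹ : GL (Fin 3) K) : Matrix (Fin 3) (Fin 3) K)) *ᵥ ((A : Matrix (Fin 3) (Fin 3) K) *ᵥ fun m => (ϖ ^ d₀)⁻¹ * (s m - s j) * c m)) m) =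
      (A : Matrix (Fin 3) (Fin 3) K) *ᵥ (fun m => ((ϖ ^ d₀)⁻¹ * (s m - s k)) * ((ϖ ^ d₀)⁻¹ * (s m - s j)) * c m) := by
    have h := mulVec_mul_inv_mulVec_mulVec A (fun m => (ϖ ^ d₀)⁻¹ * (s m - s k)) (fun m => (ϖ ^ d₀)⁻¹ * (s m - s j)) c
    simpa only [mul_assoc] using h
  rw [hcomp] at hTkTj
  -- the product vector is supported at `i₀`
  have hsupp : ∀ m, m ≠ i₀ → ((ϖ ^ d₀)⁻¹ * (s m - s k)) * ((ϖ ^ d₀)⁻¹ * (s m - s j)) * c m = 0 := by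
    intro m hm
    rcases (fin_three_eq_or i₀ m).1 with h | h | h
    · exact absurd h hm
    · rw [show s m - s j = 0 by rw [h, hjdef, sub_self]]; ring
    · rw [show s m - s k = 0 by rw [h, hkdef, sub_self]]; ring
  rw [mulVec_eq_smul_mulVec_single_of_forall_ne _ i₀ hsupp] at hTkTj
  -- divide by the unit `e = ϖ^{-2d₀}(s_{i₀} − s_k)(s_{i₀} − s_j)`
  set e : K := ((ϖ ^ d₀)⁻¹ * (s i₀ - s k)) * ((ϖ ^ d₀)⁻¹ * (s i₀ - s j)) with hedef
  have hve : Valued.v e = 1 := by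
    rw [hedef, map_mul, map_mul, map_mul, map_inv₀, map_pow, hiso k hk, hiso j hj, inv_mul_cancel₀ (pow_ne_zero _ hvϖ0), one_mul]
  have he0 : e ≠ 0 := fun h0 => by rw [h0, map_zero] at hve; exact zero_ne_one hve
  have h := smul_mem_of_v_le_one M (show Valued.v e⁻¹ ≤ 1 by rw [map_inv₀, hve, inv_one]) hTkTj
  rwa [smul_smul, show e⁻¹ * (e * c i₀) = c i₀ by field_simp] at h

omit [Valued K ℤᵐ⁰] in
/-- Three pairwise distinct indices cover `Fin 3`. [cite: Serre1980Trees, II.1.1] -/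
theorem fin_three_cover {i₀ j k : Fin 3} (hj : j ≠ i₀) (hk : k ≠ i₀) (hjk : j ≠ k) (m : Fin 3) : m = i₀ ∨ m = j ∨ m = k := by
  fin_cases i₀ <;> fin_cases j <;> fin_cases k <;> fin_cases m <;> simp (config := { decide := true }) at hj hk hjk ⊢

omit [Valued K ℤᵐ⁰] in
/-- A vector supported at two indices: `A·w = w_{i}·(A e_i) + w_{k}·(A e_k)` if `w_j = 0` and `{i, j, k} = Fin 3`. [cite: Kottwitz1986, §3] -/
theorem mulVec_eq_add_of_apply_eq_zero (A : Matrix (Fin 3) (Fin 3) K) {i₀ j k : Fin 3} (hj : j ≠ i₀) (hk : k ≠ i₀) (hjk : j ≠ k) {w : Fin 3 → K} (hw : w j = 0) :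
    A *ᵥ w = w i₀ • (A *ᵥ Pi.single i₀ 1) + w k • (A *ᵥ Pi.single k 1) := by
  have hws : w = w i₀ • (Pi.single i₀ 1 : Fin 3 → K) + w k • (Pi.single k 1 : Fin 3 → K) := by
    funext m
    rcases fin_three_cover hj hk hjk m with rfl | rfl | rfl
    · rw [Pi.add_apply, Pi.smul_apply, Pi.smul_apply, Pi.single_eq_same, Pi.single_eq_of_ne hk.symm, smul_eq_mul, smul_eq_mul, mul_one, mul_zero, add_zero]
    · rw [hw, Pi.add_apply, Pi.smul_apply, Pi.smul_apply, Pi.single_eq_of_ne hj, Pi.single_eq_of_ne hjk, smul_eq_mul, smul_eq_mul, mul_zero, mul_zero, add_zero]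
    · rw [Pi.add_apply, Pi.smul_apply, Pi.smul_apply, Pi.single_eq_of_ne hk, Pi.single_eq_same, smul_eq_mul, smul_eq_mul, mul_zero, mul_one, zero_add]
  conv_lhs => rw [hws]
  rw [Matrix.mulVec_add, Matrix.mulVec_smul, Matrix.mulVec_smul]

/-- **`LEV[M](ϖ^{d₀})` ⇒ `ϖ^{2s'}`·(the `u_k`-coordinate projection) preserves `M`**: `ϖ^{2s'}·c_k(z)·u_k ∈ M` for `z ∈ M`, `k ≠ i₀` (any `𝒪`-submodule `M`; the close-pair gap
is EXACTLY `|s_j − s_k| = |ϖ|^{d₀+2s'}`): `T_j z = e'·c_{i₀}(z)u_{i₀} + e''·c_k(z)u_k` with `|e''| = |ϖ|^{2s'}`. [cite: Kottwitz1986, §3] [cite: BruhatTits1972, §10] -/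
theorem pow_mul_coord_smul_mulVec_single_mem_of_lev (hϖ : Valued.v ϖ = WithZero.exp (-1 : ℤ)) (A : GL (Fin 3) K) (s : Fin 3 → K) {γm : Matrix (Fin 3) (Fin 3) K}
    (hγA : γm = (A : Matrix (Fin 3) (Fin 3) K) * Matrix.diagonal s * ((A⁻¹ : GL (Fin 3) K) : Matrix (Fin 3) (Fin 3) K)) (i₀ : Fin 3) {d₀ : ℕ}
    (he : ∀ i, Valued.v (s i - 1) ≤ Valued.v ϖ ^ d₀) (hiso : ∀ m, m ≠ i₀ → Valued.v (s i₀ - s m) = Valued.v ϖ ^ d₀) {s' : ℕ}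
    (hgap : ∀ j k, j ≠ i₀ → k ≠ i₀ → j ≠ k → Valued.v (s j - s k) = Valued.v ϖ ^ (d₀ + 2 * s'))
    {M : Submodule 𝒪[K] (Fin 3 → K)} (hlev : M.map ((Matrix.toLin' (γm - 1)).restrictScalars 𝒪[K]) ≤ scaleLattice (ϖ ^ d₀) M) {z : Fin 3 → K} (hz : z ∈ M)
    {k : Fin 3} (hk : k ≠ i₀) :
    (ϖ ^ (2 * s') * ((((A⁻¹ : GL (Fin 3) K) : Matrix (Fin 3) (Fin 3) K)) *ᵥ z) k) • ((A : Matrix (Fin 3) (Fin 3) K) *ᵥ Pi.single k 1) ∈ M := by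
  have hϖ0 : ϖ ≠ 0 := fun h0 => by rw [h0, map_zero] at hϖ; exact WithZero.coe_ne_zero hϖ.symm
  have hvϖ0 : Valued.v ϖ ≠ 0 := (Valuation.ne_zero_iff _).2 hϖ0
  -- the third index `j`
  obtain ⟨j, hj, hjk⟩ : ∃ j : Fin 3, j ≠ i₀ ∧ j ≠ k := by
    rcases (fin_three_eq_or i₀ k).1 with h | h | h
    · exact absurd h hk
    · exact ⟨i₀ + 2, (fin_three_eq_or i₀ k).2.2.1, by rw [h]; exact (fin_three_eq_or i₀ k).2.2.2.symm⟩
    · exact ⟨i₀ + 1, (fin_three_eq_or i₀ k).2.1, by rw [h]; exact (fin_three_eq_or i₀ k).2.2.2⟩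
  set c : Fin 3 → K := (((A⁻¹ : GL (Fin 3) K) : Matrix (Fin 3) (Fin 3) K)) *ᵥ z with hc
  have hTj := mulVec_levelShift_mem_of_lev hϖ A s hγA j (he j) hlev hz
  rw [← hc] at hTj
  rw [mulVec_eq_add_of_apply_eq_zero _ hj hk hjk (show (ϖ ^ d₀)⁻¹ * (s j - s j) * c j = 0 by rw [sub_self]; ring)] at hTj
  -- subtract the `i₀`-term (in `M` by the previous theorem)
  have h0 : ((ϖ ^ d₀)⁻¹ * (s i₀ - s j) * c i₀) • ((A : Matrix (Fin 3) (Fin 3) K) *ᵥ Pi.single i₀ 1) ∈ M := by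
    rw [← smul_smul]
    refine smul_mem_of_v_le_one M ?_ (coord_smul_mulVec_single_mem_of_lev hϖ A s hγA i₀ he hiso hlev hz)
    rw [map_mul, map_inv₀, map_pow, hiso j hj, inv_mul_cancel₀ (pow_ne_zero _ hvϖ0)]
  have h1 := M.sub_mem hTj h0
  rw [add_sub_cancel_left] at h1
  -- divide by the unit `ϖ^{-d₀}(s_k − s_j)∕ϖ^{2s'}`
  set f : K := (ϖ ^ d₀)⁻¹ * (s k - s j) * (ϖ ^ (2 * s'))⁻¹ with hfdef
  have hvf : Valued.v f = 1 := by
    rw [hfdef, map_mul, map_mul, map_inv₀, map_inv₀, map_pow, map_pow, hgap k j hk hj hjk.symm, pow_add, ← mul_assoc, inv_mul_cancel₀ (pow_ne_zero _ hvϖ0), one_mul,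
      mul_inv_cancel₀ (pow_ne_zero _ hvϖ0)]
  have hf0 : f ≠ 0 := fun h0 => by rw [h0, map_zero] at hvf; exact zero_ne_one hvf
  have hsk : s k - s j ≠ 0 := fun h0 => by
    have h := hgap k j hk hj hjk.symm
    rw [h0, map_zero] at h
    exact pow_ne_zero _ hvϖ0 h.symm
  have h2 := smul_mem_of_v_le_one M (show Valued.v f⁻¹ ≤ 1 by rw [map_inv₀, hvf, inv_one]) h1
  have hcoef : f⁻¹ * ((ϖ ^ d₀)⁻¹ * (s k - s j) * c k) = ϖ ^ (2 * s') * c k := by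
    rw [hfdef]
    field_simp
  rwa [smul_smul, hcoef] at h2

/-- **THE MODULE CRITERION, converse half**: if the `u_{i₀}`-coordinate projection and `ϖ^{2s'}`·(the `u_k`-projection) preserve `M` (one `k ≠ i₀`), then `LEV[M](ϖ^{d₀})` —
`(γ−1)z = (s_j−1)z + (s_{i₀}−s_j)c_{i₀}u_{i₀} + (s_k−s_j)c_ku_k` with `|s_j − 1|, |s_{i₀} − s_j| ≤ |ϖ|^{d₀}` and `|s_k − s_j| ≤ |ϖ|^{d₀+2s'}`. [cite: Kottwitz1986, §3] -/
theorem lev_of_coord_smul_mulVec_single_mem (hϖ : Valued.v ϖ = WithZero.exp (-1 : ℤ)) (A : GL (Fin 3) K) (s : Fin 3 → K) {γm : Matrix (Fin 3) (Fin 3) K}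
    (hγA : γm = (A : Matrix (Fin 3) (Fin 3) K) * Matrix.diagonal s * ((A⁻¹ : GL (Fin 3) K) : Matrix (Fin 3) (Fin 3) K)) (i₀ : Fin 3) {d₀ : ℕ}
    (he : ∀ i, Valued.v (s i - 1) ≤ Valued.v ϖ ^ d₀) {s' : ℕ}
    (hclose : ∀ j k, j ≠ i₀ → k ≠ i₀ → Valued.v (s j - s k) ≤ Valued.v ϖ ^ (d₀ + 2 * s')) {k : Fin 3} (hk : k ≠ i₀)
    {M : Submodule 𝒪[K] (Fin 3 → K)}
    (h₀ : ∀ z ∈ M, ((((A⁻¹ : GL (Fin 3) K) : Matrix (Fin 3) (Fin 3) K)) *ᵥ z) i₀ • ((A : Matrix (Fin 3) (Fin 3) K) *ᵥ Pi.single i₀ 1) ∈ M)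
    (hK : ∀ z ∈ M, (ϖ ^ (2 * s') * ((((A⁻¹ : GL (Fin 3) K) : Matrix (Fin 3) (Fin 3) K)) *ᵥ z) k) • ((A : Matrix (Fin 3) (Fin 3) K) *ᵥ Pi.single k 1) ∈ M) :
    M.map ((Matrix.toLin' (γm - 1)).restrictScalars 𝒪[K]) ≤ scaleLattice (ϖ ^ d₀) M := by
  have hϖ0 : ϖ ≠ 0 := fun h0 => by rw [h0, map_zero] at hϖ; exact WithZero.coe_ne_zero hϖ.symm
  have hvϖ0 : Valued.v ϖ ≠ 0 := (Valuation.ne_zero_iff _).2 hϖ0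
  have hpd : (ϖ : K) ^ d₀ ≠ 0 := pow_ne_zero _ hϖ0
  have hvpd : Valued.v ϖ ^ d₀ ≠ 0 := pow_ne_zero _ hvϖ0
  obtain ⟨j, hj, hjk⟩ : ∃ j : Fin 3, j ≠ i₀ ∧ j ≠ k := by
    rcases (fin_three_eq_or i₀ k).1 with h | h | h
    · exact absurd h hk
    · exact ⟨i₀ + 2, (fin_three_eq_or i₀ k).2.2.1, by rw [h]; exact (fin_three_eq_or i₀ k).2.2.2.symm⟩
    · exact ⟨i₀ + 1, (fin_three_eq_or i₀ k).2.1, by rw [h]; exact (fin_three_eq_or i₀ k).2.2.2⟩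
  rintro _ ⟨z, hz, rfl⟩
  rw [LinearMap.restrictScalars_apply, Matrix.toLin'_apply, mem_scaleLattice_iff hpd]
  set c : Fin 3 → K := (((A⁻¹ : GL (Fin 3) K) : Matrix (Fin 3) (Fin 3) K)) *ᵥ z with hc
  have hsplit : (γm - 1) *ᵥ z = (s j - 1) • z + (A : Matrix (Fin 3) (Fin 3) K) *ᵥ (fun m => (s m - s j) * c m) := by
    rw [← sub_one_mulVec_sub_smul_eq A s hγA j z, add_sub_cancel]
  rw [hsplit, mulVec_eq_add_of_apply_eq_zero _ hj hk hjk (show (s j - s j) * c j = 0 by rw [sub_self, zero_mul]), smul_add, smul_add, smul_smul, smul_smul, smul_smul]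
  refine M.add_mem (smul_mem_of_v_le_one M ?_ hz) (M.add_mem ?_ ?_)
  · rw [map_mul, map_inv₀, map_pow]
    calc (Valued.v ϖ ^ d₀)⁻¹ * Valued.v (s j - 1) ≤ (Valued.v ϖ ^ d₀)⁻¹ * Valued.v ϖ ^ d₀ := mul_le_mul' le_rfl (he j)
      _ = 1 := inv_mul_cancel₀ hvpd
  · rw [show (ϖ ^ d₀)⁻¹ * ((s i₀ - s j) * c i₀) = ((ϖ ^ d₀)⁻¹ * (s i₀ - s j)) * c i₀ by ring, ← smul_smul]
    refine smul_mem_of_v_le_one M ?_ (h₀ z hz)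
    rw [map_mul, map_inv₀, map_pow]
    have hd : Valued.v (s i₀ - s j) ≤ Valued.v ϖ ^ d₀ := by
      rw [show s i₀ - s j = (s i₀ - 1) - (s j - 1) by ring]
      exact (Valuation.map_sub _ _ _).trans (max_le (he i₀) (he j))
    calc (Valued.v ϖ ^ d₀)⁻¹ * Valued.v (s i₀ - s j) ≤ (Valued.v ϖ ^ d₀)⁻¹ * Valued.v ϖ ^ d₀ := mul_le_mul' le_rfl hd
      _ = 1 := inv_mul_cancel₀ hvpd
  · rw [show (ϖ ^ d₀)⁻¹ * ((s k - s j) * c k) = ((ϖ ^ d₀)⁻¹ * (s k - s j) * (ϖ ^ (2 * s'))⁻¹) * (ϖ ^ (2 * s') * c k) by field_simp, ← smul_smul]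
    refine smul_mem_of_v_le_one M ?_ (hK z hz)
    rw [map_mul, map_mul, map_inv₀, map_inv₀, map_pow, map_pow]
    calc (Valued.v ϖ ^ d₀)⁻¹ * Valued.v (s k - s j) * (Valued.v ϖ ^ (2 * s'))⁻¹
        ≤ (Valued.v ϖ ^ d₀)⁻¹ * Valued.v ϖ ^ (d₀ + 2 * s') * (Valued.v ϖ ^ (2 * s'))⁻¹ := mul_le_mul' (mul_le_mul' le_rfl (hclose k j hk hj)) le_rfl
      _ = 1 := by rw [pow_add, ← mul_assoc, inv_mul_cancel₀ hvpd, one_mul, mul_inv_cancel₀ (pow_ne_zero _ hvϖ0)]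

/-! ## §3 Self-dual lattices: the eigenframe pairing dictionary and the REGION CRITERION -/

omit [Valued K ℤᵐ⁰] in
/-- The Gram matrix of the eigenframe: `formCongr σ A J₀ = (−det diag d)⁻¹ • diag d` (the junction's binder `hdA` solved for the Gram matrix). [cite: Kottwitz1986, §3] -/
theorem formCongr_eq_smul_diagonal_of_eq (A : GL (Fin 3) K) {d : Fin 3 → K} (hd0 : ∀ i, d i ≠ 0)
    (hdA : Matrix.diagonal d = (-(Matrix.diagonal d).det) • formCongr σ A ((StdForm.antidiagonal 3).over K)) :
    formCongr σ A ((StdForm.antidiagonal 3).over K) = (-(Matrix.diagonal d).det)⁻¹ • Matrix.diagonal d := by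
  have hdet : -(Matrix.diagonal d).det ≠ 0 := by
    rw [neg_ne_zero, Matrix.det_diagonal]; exact Finset.prod_ne_zero_iff.2 fun i _ => hd0 i
  have h : (-(Matrix.diagonal d).det)⁻¹ • Matrix.diagonal d = formCongr σ A ((StdForm.antidiagonal 3).over K) := by
    conv_lhs => arg 2; rw [hdA]
    rw [smul_smul, inv_mul_cancel₀ hdet, one_smul]
  exact h.symm

omit [Valued K ℤᵐ⁰] in
/-- `pairing σ (c • H) x y = c · pairing σ H x y`. [cite: Kottwitz1986, §3] -/
theorem pairing_smul_form_apply {N : ℕ} (c : K) (H : Matrix (Fin N) (Fin N) K) (x y : Fin N → K) :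
    pairing σ (c • H) x y = c * pairing σ H x y := by
  rw [pairing_apply, pairing_apply, Finset.mul_sum]
  refine Finset.sum_congr rfl fun i _ => ?_
  rw [Finset.mul_sum]
  refine Finset.sum_congr rfl fun j _ => ?_
  rw [Matrix.smul_apply, smul_eq_mul]
  ring

omit [Valued K ℤᵐ⁰] in
/-- **THE EIGENFRAME PAIRING**: `⟨A x, A y⟩ = (−det diag d)⁻¹ · Σ_i σ(x_i)·d_i·y_i`. [cite: Kottwitz1986, §3] [cite: BruhatTits1972, §10] -/
theorem pairing_coe_mulVec_coe_mulVec_eq_sum (A : GL (Fin 3) K) {d : Fin 3 → K} (hd0 : ∀ i, d i ≠ 0)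
    (hdA : Matrix.diagonal d = (-(Matrix.diagonal d).det) • formCongr σ A ((StdForm.antidiagonal 3).over K)) (x y : Fin 3 → K) :
    pairing σ ((StdForm.antidiagonal 3).over K) ((A : Matrix (Fin 3) (Fin 3) K) *ᵥ x) ((A : Matrix (Fin 3) (Fin 3) K) *ᵥ y) =
      (-(Matrix.diagonal d).det)⁻¹ * ∑ i, σ (x i) * d i * y i := by
  rw [pairing_mulVec_mulVec, formCongr_eq_smul_diagonal_of_eq A hd0 hdA, pairing_smul_form_apply, pairing_diagonal_apply]

omit [Valued K ℤᵐ⁰] in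
/-- `⟨z, u_m⟩ = (−det diag d)⁻¹·σ(c_m(z))·d_m` (`u_m = A e_m`, `c(z) = A⁻¹z`). [cite: Kottwitz1986, §3] -/
theorem pairing_coe_mulVec_single_eq (A : GL (Fin 3) K) {d : Fin 3 → K} (hd0 : ∀ i, d i ≠ 0)
    (hdA : Matrix.diagonal d = (-(Matrix.diagonal d).det) • formCongr σ A ((StdForm.antidiagonal 3).over K)) (z : Fin 3 → K) (m : Fin 3) :
    pairing σ ((StdForm.antidiagonal 3).over K) z ((A : Matrix (Fin 3) (Fin 3) K) *ᵥ Pi.single m 1) =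
      (-(Matrix.diagonal d).det)⁻¹ * (σ ((((A⁻¹ : GL (Fin 3) K) : Matrix (Fin 3) (Fin 3) K) *ᵥ z) m) * d m) := by
  conv_lhs => rw [← coe_mulVec_inv_mulVec A z]
  rw [pairing_coe_mulVec_coe_mulVec_eq_sum A hd0 hdA, Finset.sum_eq_single m]
  · rw [Pi.single_eq_same, mul_one]
  · intro b _ hb; rw [Pi.single_eq_of_ne hb, mul_zero]
  · intro h; exact absurd (Finset.mem_univ m) h

omit [Valued K ℤᵐ⁰] in
/-- `⟨u_m, z⟩ = (−det diag d)⁻¹·d_m·c_m(z)`. [cite: Kottwitz1986, §3] -/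
theorem pairing_single_coe_mulVec_eq (A : GL (Fin 3) K) {d : Fin 3 → K} (hd0 : ∀ i, d i ≠ 0)
    (hdA : Matrix.diagonal d = (-(Matrix.diagonal d).det) • formCongr σ A ((StdForm.antidiagonal 3).over K)) (m : Fin 3) (z : Fin 3 → K) :
    pairing σ ((StdForm.antidiagonal 3).over K) ((A : Matrix (Fin 3) (Fin 3) K) *ᵥ Pi.single m 1) z =
      (-(Matrix.diagonal d).det)⁻¹ * (d m * (((A⁻¹ : GL (Fin 3) K) : Matrix (Fin 3) (Fin 3) K) *ᵥ z) m) := by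
  conv_lhs => rw [← coe_mulVec_inv_mulVec A z]
  rw [pairing_coe_mulVec_coe_mulVec_eq_sum A hd0 hdA, Finset.sum_eq_single m]
  · rw [Pi.single_eq_same, map_one, one_mul]
  · intro b _ hb; rw [Pi.single_eq_of_ne hb, map_zero, zero_mul, zero_mul]
  · intro h; exact absurd (Finset.mem_univ m) h

/-- The eigenframe scalar `(−det diag d)⁻¹` is a unit when the `d_i` are. [cite: Kottwitz1986, §3] -/
theorem v_inv_neg_det_diagonal_eq_one {d : Fin 3 → K} (hd : ∀ i, Valued.v (d i) = 1) : Valued.v ((-(Matrix.diagonal d).det)⁻¹) = 1 := by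
  rw [map_inv₀, Valuation.map_neg, Matrix.det_diagonal, map_prod, Finset.prod_eq_one fun i _ => hd i, inv_one]

/-- In a linearly ordered commutative group with zero, `a·a ≤ 1 ⇒ a ≤ 1`. [cite: Serre1980Trees, II.1.1] -/
theorem le_one_of_mul_self_le_one {a : ℤᵐ⁰} (h : a * a ≤ 1) : a ≤ 1 := by
  by_contra hlt
  rw [not_le] at hlt
  exact absurd h (not_le.2 (one_lt_mul'' hlt hlt))

/-- **SELF-DUAL `M`: the `u_{i₀}`-projection preserves `M` iff `u_{i₀} ∈ M`** (⇒: `y = c_{i₀}(x)u_{i₀} ∈ M` has `|⟨y,y⟩| = |c_{i₀}(x)|² ≤ 1`, so `|⟨x, u_{i₀}⟩| ≤ 1` for all `x ∈ M`,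
i.e. `u_{i₀} ∈ M♯ = M`; ⇐: `|c_{i₀}(z)| = |⟨u_{i₀}, z⟩| ≤ 1`). [cite: Kottwitz1986, §3] [cite: BruhatTits1972, §10] -/
theorem coe_mulVec_single_mem_iff_forall_coord_smul_mem (hσ : ∀ x, σ (σ x) = x) (hvσ : ∀ a, Valued.v (σ a) = Valued.v a)
    (A : GL (Fin 3) K) {d : Fin 3 → K} (hd : ∀ i, Valued.v (d i) = 1)
    (hdA : Matrix.diagonal d = (-(Matrix.diagonal d).det) • formCongr σ A ((StdForm.antidiagonal 3).over K))
    {M : Submodule 𝒪[K] (Fin 3 → K)} (hM : IsSelfDualLattice σ ϖ ((StdForm.antidiagonal 3).over K) M) (m : Fin 3) :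
    (A : Matrix (Fin 3) (Fin 3) K) *ᵥ Pi.single m 1 ∈ M ↔
      ∀ z ∈ M, ((((A⁻¹ : GL (Fin 3) K) : Matrix (Fin 3) (Fin 3) K)) *ᵥ z) m • ((A : Matrix (Fin 3) (Fin 3) K) *ᵥ Pi.single m 1) ∈ M := by
  have hd0 : ∀ i, d i ≠ 0 := fun i h0 => by have h := hd i; rw [h0, map_zero] at h; exact zero_ne_one h
  have hκ := v_inv_neg_det_diagonal_eq_one hd
  have hint : ∀ {x w : Fin 3 → K}, x ∈ M → w ∈ M → Valued.v (pairing σ ((StdForm.antidiagonal 3).over K) x w) ≤ 1 := fun hx hw => by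
    rw [pairing_antidiagonal]; exact v_B₀_le_one_of_isSelfDualLattice hσ hvσ hM hx hw
  constructor
  · intro hu z hz
    refine smul_mem_of_v_le_one M ?_ hu
    have h := hint hu hz
    rwa [pairing_single_coe_mulVec_eq A hd0 hdA, map_mul, map_mul, hκ, hd m, one_mul, one_mul] at h
  · intro h
    rw [← dualLatt_eq_self_of_isSelfDualLattice hvσ isUnit_det_antidiagonal hM, mem_dualLatt]
    intro x hx
    have hy := h x hx
    have hyy := hint hy hy
    set c : K := ((((A⁻¹ : GL (Fin 3) K) : Matrix (Fin 3) (Fin 3) K)) *ᵥ x) m with hcdef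
    have hpyy : pairing σ ((StdForm.antidiagonal 3).over K) (c • ((A : Matrix (Fin 3) (Fin 3) K) *ᵥ Pi.single m 1)) (c • ((A : Matrix (Fin 3) (Fin 3) K) *ᵥ Pi.single m 1)) =
        σ c * (c * ((-(Matrix.diagonal d).det)⁻¹ * d m)) := by
      rw [LinearMap.map_smulₛₗ₂, LinearMap.map_smul, smul_eq_mul, smul_eq_mul, pairing_coe_mulVec_single_eq A hd0 hdA, inv_mulVec_coe_mulVec, Pi.single_eq_same, map_one,
        one_mul]
    rw [hpyy, map_mul, map_mul, map_mul, hvσ, hκ, hd m, one_mul, mul_one] at hyy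
    have hc : Valued.v ((((A⁻¹ : GL (Fin 3) K) : Matrix (Fin 3) (Fin 3) K) *ᵥ x) m) ≤ 1 := le_one_of_mul_self_le_one hyy
    rw [pairing_coe_mulVec_single_eq A hd0 hdA, map_mul, map_mul, hκ, hvσ, hd m, one_mul, mul_one]
    exact hc

/-- **SELF-DUAL `M`: `ϖ^{2n}`·(the `u_k`-projection) preserves `M` iff `ϖⁿ·u_k ∈ M`** (⇒: pairing `x` with `y = ϖ^{2n}c_k(x)u_k ∈ M` gives `(|ϖ|ⁿ|c_k(x)|)² ≤ 1`, so
`ϖⁿu_k ∈ M♯ = M`; ⇐: `ϖ^{2n}c_k(z)u_k = (ϖⁿc_k(z))·(ϖⁿu_k)` with `|ϖⁿc_k(z)| = |⟨ϖⁿu_k, z⟩| ≤ 1`). [cite: Kottwitz1986, §3] [cite: BruhatTits1972, §10] -/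
theorem pow_smul_coe_mulVec_single_mem_iff_forall (hσ : ∀ x, σ (σ x) = x) (hvσ : ∀ a, Valued.v (σ a) = Valued.v a)
    (A : GL (Fin 3) K) {d : Fin 3 → K} (hd : ∀ i, Valued.v (d i) = 1)
    (hdA : Matrix.diagonal d = (-(Matrix.diagonal d).det) • formCongr σ A ((StdForm.antidiagonal 3).over K))
    {M : Submodule 𝒪[K] (Fin 3 → K)} (hM : IsSelfDualLattice σ ϖ ((StdForm.antidiagonal 3).over K) M) (m : Fin 3) (n : ℕ) :
    ϖ ^ n • ((A : Matrix (Fin 3) (Fin 3) K) *ᵥ Pi.single m 1) ∈ M ↔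
      ∀ z ∈ M, (ϖ ^ (2 * n) * ((((A⁻¹ : GL (Fin 3) K) : Matrix (Fin 3) (Fin 3) K)) *ᵥ z) m) • ((A : Matrix (Fin 3) (Fin 3) K) *ᵥ Pi.single m 1) ∈ M := by
  have hd0 : ∀ i, d i ≠ 0 := fun i h0 => by have h := hd i; rw [h0, map_zero] at h; exact zero_ne_one h
  have hκ := v_inv_neg_det_diagonal_eq_one hd
  have hint : ∀ {x w : Fin 3 → K}, x ∈ M → w ∈ M → Valued.v (pairing σ ((StdForm.antidiagonal 3).over K) x w) ≤ 1 := fun hx hw => by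
    rw [pairing_antidiagonal]; exact v_B₀_le_one_of_isSelfDualLattice hσ hvσ hM hx hw
  have hσpow : Valued.v (σ (ϖ ^ n)) = Valued.v ϖ ^ n := by rw [hvσ, map_pow]
  constructor
  · intro hu z hz
    rw [show ϖ ^ (2 * n) * ((((A⁻¹ : GL (Fin 3) K) : Matrix (Fin 3) (Fin 3) K)) *ᵥ z) m =
        (ϖ ^ n * ((((A⁻¹ : GL (Fin 3) K) : Matrix (Fin 3) (Fin 3) K)) *ᵥ z) m) * ϖ ^ n by ring, ← smul_smul]
    refine smul_mem_of_v_le_one M ?_ hu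
    have h := hint hu hz
    rwa [LinearMap.map_smulₛₗ₂, smul_eq_mul, pairing_single_coe_mulVec_eq A hd0 hdA, map_mul, map_mul, map_mul, hσpow, hκ, hd m, one_mul, one_mul,
      ← map_pow, ← map_mul] at h
  · intro h
    rw [← dualLatt_eq_self_of_isSelfDualLattice hvσ isUnit_det_antidiagonal hM, mem_dualLatt]
    intro x hx
    have hy := h x hx
    have hxy := hint hx hy
    rw [map_smul, smul_eq_mul, pairing_coe_mulVec_single_eq A hd0 hdA, map_mul, map_mul, map_mul, map_mul, hκ, hvσ, hd m, one_mul, mul_one, map_pow] at hxy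
    -- `hxy : |ϖ|^{2n} · |c| · |c| ≤ 1`
    have hsq : (Valued.v ϖ ^ n * Valued.v ((((A⁻¹ : GL (Fin 3) K) : Matrix (Fin 3) (Fin 3) K) *ᵥ x) m)) *
        (Valued.v ϖ ^ n * Valued.v ((((A⁻¹ : GL (Fin 3) K) : Matrix (Fin 3) (Fin 3) K) *ᵥ x) m)) ≤ 1 := by
      rw [mul_mul_mul_comm, ← pow_add, ← two_mul, ← mul_assoc]
      exact hxy
    have hc := le_one_of_mul_self_le_one hsq
    rw [map_smul, smul_eq_mul, pairing_coe_mulVec_single_eq A hd0 hdA, map_mul, map_mul, map_mul, hκ, hvσ, hd m, one_mul, mul_one, map_pow]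
    exact hc

/-- **THE ISOCELES REGION CRITERION.**  Tame-ramified or not: for a SELF-DUAL lattice `M` (w.r.t. `J₀`), the eigenframe `γ = A·diag(s)·A⁻¹` with Gram matrix
`diag(d)∕(−det diag d)` (unit `d`), the isoceles eigen-data at `i₀` (`|s_m − 1| ≤ |ϖ|^{d₀}`, `|s_{i₀} − s_m| = |ϖ|^{d₀}` for `m ≠ i₀`, close-pair gap EXACTLY
`|ϖ|^{d₀+2s'}`) and any `k ≠ i₀`:  **`(γ − 1)·M ≤ ϖ^{d₀}·M ↔ u_{i₀} ∈ M ∧ ϖ^{s'}·u_k ∈ M`** (`u_m = A e_m`).  The region of the isoceles junction is the set of self-dual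
lattices SPLIT along the isolated eigenline and containing `ϖ^{s'}u_k` («content ≤ s'»). [cite: Kottwitz1986, §3] [cite: BruhatTits1972, §10] -/
theorem map_sub_one_le_scaleLattice_iff_mem_and_mem_of_isSelfDualLattice (hσ : ∀ x, σ (σ x) = x) (hvσ : ∀ a, Valued.v (σ a) = Valued.v a)
    (hϖ : Valued.v ϖ = WithZero.exp (-1 : ℤ)) (A : GL (Fin 3) K) {d : Fin 3 → K} (hd : ∀ i, Valued.v (d i) = 1)
    (hdA : Matrix.diagonal d = (-(Matrix.diagonal d).det) • formCongr σ A ((StdForm.antidiagonal 3).over K))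
    (s : Fin 3 → K) {γm : Matrix (Fin 3) (Fin 3) K} (hγA : γm = (A : Matrix (Fin 3) (Fin 3) K) * Matrix.diagonal s * ((A⁻¹ : GL (Fin 3) K) : Matrix (Fin 3) (Fin 3) K))
    (i₀ : Fin 3) {d₀ : ℕ} (he : ∀ i, Valued.v (s i - 1) ≤ Valued.v ϖ ^ d₀) (hiso : ∀ m, m ≠ i₀ → Valued.v (s i₀ - s m) = Valued.v ϖ ^ d₀) {s' : ℕ}
    (hgap : ∀ j k, j ≠ i₀ → k ≠ i₀ → j ≠ k → Valued.v (s j - s k) = Valued.v ϖ ^ (d₀ + 2 * s'))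
    {M : Submodule 𝒪[K] (Fin 3 → K)} (hM : IsSelfDualLattice σ ϖ ((StdForm.antidiagonal 3).over K) M) {k : Fin 3} (hk : k ≠ i₀) :
    M.map ((Matrix.toLin' (γm - 1)).restrictScalars 𝒪[K]) ≤ scaleLattice (ϖ ^ d₀) M ↔
      (A : Matrix (Fin 3) (Fin 3) K) *ᵥ Pi.single i₀ 1 ∈ M ∧ ϖ ^ s' • ((A : Matrix (Fin 3) (Fin 3) K) *ᵥ Pi.single k 1) ∈ M := by
  have hϖ0 : ϖ ≠ 0 := fun h0 => by rw [h0, map_zero] at hϖ; exact WithZero.coe_ne_zero hϖ.symm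
  have hϖ1 : Valued.v ϖ ≤ 1 := by rw [hϖ, ← WithZero.exp_zero]; exact WithZero.exp_le_exp.2 (by norm_num)
  have hclose : ∀ j k, j ≠ i₀ → k ≠ i₀ → Valued.v (s j - s k) ≤ Valued.v ϖ ^ (d₀ + 2 * s') := by
    intro j k hj hk
    by_cases hjk : j = k
    · rw [hjk, sub_self, map_zero]; exact zero_le
    · exact (hgap j k hj hk hjk).le
  constructor
  · intro hlev
    exact ⟨(coe_mulVec_single_mem_iff_forall_coord_smul_mem hσ hvσ A hd hdA hM i₀).2 fun z hz => coord_smul_mulVec_single_mem_of_lev hϖ A s hγA i₀ he hiso hlev hz,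
      (pow_smul_coe_mulVec_single_mem_iff_forall hσ hvσ A hd hdA hM k s').2 fun z hz =>
        pow_mul_coord_smul_mulVec_single_mem_of_lev hϖ A s hγA i₀ he hiso hgap hlev hz hk⟩
  · rintro ⟨h₀, hK⟩
    exact lev_of_coord_smul_mulVec_single_mem hϖ A s hγA i₀ he hclose hk
      ((coe_mulVec_single_mem_iff_forall_coord_smul_mem hσ hvσ A hd hdA hM i₀).1 h₀) ((pow_smul_coe_mulVec_single_mem_iff_forall hσ hvσ A hd hdA hM k s').1 hK)

end Literature.NumberTheory.Automorphic.UnitaryLatticeTree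

end
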